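import Mathlib.RingTheory.PowerSeries.Trunc
import Summits.BirchSwinnertonDyer.BirchSwinnertonDyer.Theorems.ResidualThetaTransportAtTwoThetaLayerLambdaCongruenceAtTwoLayerLambdaStable
import Literature.NumberTheory.IwasawaTheory.LayerIwasawaInvariants
import HarnessLib

/-!
# Layer algebra for crux `ThetaLayerLambdaCongruenceAtTwo` (stmt-BirchSwinnertonDyer-20688, route
# ResidualThetaTransportAtTwo): the layer `λ`-invariant of PRODUCTS and of REDUCTIONS modulo
# `ω_n = (X+1)^{pⁿ} − 1` (Pollack–Weston §3.1 bookkeeping, proved)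
# (lead prover bsd-wall-rtt-p3 g0; `--supports stmt-BirchSwinnertonDyer-20688 --as helper`; closes nothing)

HONEST FRAMING. Pure normed algebra over an ultrametric normed field (`PadicAlgCl p`, `ℚ_p`, …); nothing about any
curve or form is asserted; BSD is not proved by any of this.

WHY. Every layer statement of this route reads `λ` of an element of the shape `(θ · ∏_{v∈S₀} P_v) %ₘ ω_n` (the
crux Kan⁺ 20688, its stubs (H)/(μ), the two-layer children R1/R2 of Kλ⁺ 20787 «λ(G) + Σ s_v d̄_v + (2ⁿ−1)/3 =
λ_n(θ^{S₀}_n(W))»). The two facts that make such bookkeeping possible are proved here once and for all: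
* §2 **Gauss's lemma with `λ`**: over an ultrametric normed field, `‖θ·P‖_sup = ‖θ‖_sup·‖P‖_sup` and
  `λ(θ·P) = λ(θ) + λ(P)` for `θ, P ≠ 0` (`layerLambda = min {j : ‖a_j‖ = ‖·‖_sup}`; the coefficient of `θP` at
  `λθ + λP` is dominated by the single product of the two leading unit-level coefficients).
* §3 **Reduction modulo an almost-monomial monic modulus**: if `ω` is monic of degree `m` with integral
  coefficients and `‖ω − X^m‖_sup ≤ δ`, then `‖F %ₘ ω − trunc_m F‖_sup ≤ δ·‖F‖_sup` for every `F` (division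
  algorithm, induction on the degree); hence (§4) for `δ < 1` and `λ(F) < m`: `‖F %ₘ ω‖_sup = ‖F‖_sup` and
  `λ(F %ₘ ω) = λ(F)` (the landed ultrametric stability `layerLambda_eq_of_supNorm_sub_C_mul_lt`, p565681), and
  the LAYER PRODUCT RULE `λ((θ·P) %ₘ ω) = λθ + λP` whenever `λθ + λP < m`.
* the modulus of the crux, `ω_n = (X+1)^{pⁿ} − 1` over `ℚ̄_p` (monic of degree `pⁿ`, integral,
  `‖ω_n − X^{pⁿ}‖_sup ≤ p⁻¹ < 1`), and the specialised product rule are in the companion file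
  `…ThetaLayerLambdaCongruenceAtTwoLayerModulus.lean`.

References: R. Pollack, T. Weston, Duke Math. J. 156 (2011) §3.1 [PollackWeston2011MT]; R. Greenberg, V. Vatsal,
Invent. Math. 142 (2000) §1 (non-primitive `λ = λ + Σ` local terms) [GreenbergVatsal2000]; L. Washington,
*Cyclotomic fields* §7.1 (Gauss's lemma / distinguished polynomials) [Washington1997].
-/

noncomputable section

-- justification: the `Summit.BirchSwinnertonDyer.BirchSwinnertonDyer.…` path repeats a component (route-file convention)
set_option linter.dupNamespace false

open Polynomial

open Literature.NumberTheory.IwasawaTheory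

namespace Summit.BirchSwinnertonDyer.BirchSwinnertonDyer.Theorems.ThetaLayerLambdaCongruenceAtTwo

/-! ## §1. Ultrametric finite sums -/

section Sums

variable {E : Type*} [SeminormedAddCommGroup E] [IsUltrametricDist E]

/-- In an ultrametric normed group a finite sum of terms of norm `< C` (`C > 0`) has norm `< C`. [folklore] -/
theorem norm_sum_lt_of_forall_lt {ι : Type*} {s : Finset ι} {f : ι → E} {C : ℝ} (hC : 0 < C)
    (h : ∀ i ∈ s, ‖f i‖ < C) : ‖∑ i ∈ s, f i‖ < C := by
  classical
  induction s using Finset.induction_on with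
  | empty => simpa using hC
  | insert a s ha ih =>
    rw [Finset.sum_insert ha]
    exact (IsUltrametricDist.norm_add_le_max _ _).trans_lt
      (max_lt (h a (Finset.mem_insert_self a s)) (ih fun i hi ↦ h i (Finset.mem_insert_of_mem hi)))

/-- In an ultrametric normed group a finite sum of terms of norm `≤ C` (`C ≥ 0`) has norm `≤ C`. [folklore] -/
theorem norm_sum_le_of_forall_le' {ι : Type*} {s : Finset ι} {f : ι → E} {C : ℝ} (hC : 0 ≤ C)
    (h : ∀ i ∈ s, ‖f i‖ ≤ C) : ‖∑ i ∈ s, f i‖ ≤ C :=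
  IsUltrametricDist.norm_sum_le_of_forall_le_of_nonneg hC h

end Sums

/-! ## §2. Gauss's lemma with `λ`: `‖θ·P‖ = ‖θ‖·‖P‖`, `λ(θ·P) = λθ + λP` -/

section Gauss

variable {K : Type*} [NormedField K] [IsUltrametricDist K]

/-- **Gauss's lemma with the layer `λ`-invariant.** Over an ultrametric normed field, for non-zero polynomials
`θ, P`: `‖θ·P‖_sup = ‖θ‖_sup·‖P‖_sup` and `layerLambda (θ·P) = layerLambda θ + layerLambda P` — the coefficient
of `θ·P` in degree `λθ + λP` is the product of the two first maximal coefficients plus terms of strictly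
smaller norm, and every coefficient of lower degree is a sum of terms of strictly smaller norm.
[cite: PollackWeston2011MT, §3.1] -/
theorem supNorm_mul_and_layerLambda_mul {θ P : K[X]} (hθ : θ ≠ 0) (hP : P ≠ 0) :
    (θ * P).supNorm = θ.supNorm * P.supNorm ∧ layerLambda (θ * P) = layerLambda θ + layerLambda P := by
  classical
  set N := θ.supNorm with hN
  set M := P.supNorm with hM
  set i₀ := layerLambda θ with hi₀
  set j₀ := layerLambda P with hj₀
  have hNpos : 0 < N := lt_of_le_of_ne (supNorm_nonneg θ) (Ne.symm ((supNorm_eq_zero_iff θ).not.mpr hθ))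
  have hMpos : 0 < M := lt_of_le_of_ne (supNorm_nonneg P) (Ne.symm ((supNorm_eq_zero_iff P).not.mpr hP))
  have hNM : 0 < N * M := mul_pos hNpos hMpos
  -- single terms
  have hterm_le : ∀ i j, ‖θ.coeff i * P.coeff j‖ ≤ N * M := fun i j ↦ by
    rw [norm_mul]
    exact mul_le_mul (θ.le_supNorm i) (P.le_supNorm j) (norm_nonneg _) (supNorm_nonneg θ)
  have hterm_lt : ∀ i j, (i < i₀ ∨ j < j₀) → ‖θ.coeff i * P.coeff j‖ < N * M := by
    rintro i j (hi | hj)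
    · rw [norm_mul]
      calc ‖θ.coeff i‖ * ‖P.coeff j‖ ≤ ‖θ.coeff i‖ * M :=
            mul_le_mul_of_nonneg_left (P.le_supNorm j) (norm_nonneg _)
        _ < N * M := mul_lt_mul_of_pos_right (norm_coeff_lt_supNorm_of_lt_layerLambda hi) hMpos
    · rw [norm_mul]
      calc ‖θ.coeff i‖ * ‖P.coeff j‖ ≤ N * ‖P.coeff j‖ :=
            mul_le_mul_of_nonneg_right (θ.le_supNorm i) (norm_nonneg _)
        _ < N * M := mul_lt_mul_of_pos_left (norm_coeff_lt_supNorm_of_lt_layerLambda hj) hNpos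
  -- all coefficients of the product are `≤ N·M`
  have hcoeff_le : ∀ k, ‖(θ * P).coeff k‖ ≤ N * M := fun k ↦ by
    rw [coeff_mul]
    exact norm_sum_le_of_forall_le' hNM.le fun x _ ↦ hterm_le x.1 x.2
  -- below `i₀ + j₀` they are `< N·M`
  have hcoeff_lt : ∀ k < i₀ + j₀, ‖(θ * P).coeff k‖ < N * M := fun k hk ↦ by
    rw [coeff_mul]
    refine norm_sum_lt_of_forall_lt hNM fun x hx ↦ hterm_lt x.1 x.2 ?_
    rw [Finset.mem_antidiagonal] at hx
    omega
  -- at `i₀ + j₀` the norm is exactly `N·M`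
  have hmain : ‖(θ * P).coeff (i₀ + j₀)‖ = N * M := by
    have hmem : (i₀, j₀) ∈ Finset.antidiagonal (i₀ + j₀) := by simp
    rw [coeff_mul, ← Finset.add_sum_erase _ _ hmem]
    have h1 : ‖θ.coeff i₀ * P.coeff j₀‖ = N * M := by
      rw [norm_mul, norm_coeff_layerLambda, norm_coeff_layerLambda]
    have h2 : ‖∑ x ∈ (Finset.antidiagonal (i₀ + j₀)).erase (i₀, j₀), θ.coeff x.1 * P.coeff x.2‖ < N * M := by
      refine norm_sum_lt_of_forall_lt hNM fun x hx ↦ hterm_lt x.1 x.2 ?_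
      rw [Finset.mem_erase, Finset.mem_antidiagonal] at hx
      obtain ⟨hne, hsum⟩ := hx
      by_contra hcon
      push Not at hcon
      obtain ⟨h1', h2'⟩ := hcon
      apply hne
      have ha : x.1 = i₀ := by omega
      have hb : x.2 = j₀ := by omega
      exact Prod.ext ha hb
    apply norm_eq_of_norm_sub_lt_of_norm_eq (a := θ.coeff i₀ * P.coeff j₀) _ h1
    rwa [sub_add_cancel_left, norm_neg]
  have hsup : (θ * P).supNorm = N * M := by
    apply le_antisymm
    · obtain ⟨i, hi⟩ := (θ * P).exists_eq_supNorm
      rw [hi]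
      exact hcoeff_le i
    · rw [← hmain]
      exact (θ * P).le_supNorm _
  refine ⟨hsup, layerLambda_eq_iff.mpr ⟨?_, fun j hj ↦ ?_⟩⟩
  · rw [hsup]; exact hmain
  · rw [hsup]; exact hcoeff_lt j hj

/-- `‖θ·P‖_sup = ‖θ‖_sup·‖P‖_sup` over an ultrametric normed field (Gauss's lemma; both sides vanish if a factor
does). [cite: Washington1997, §7.1] -/
theorem supNorm_mul' (θ P : K[X]) : (θ * P).supNorm = θ.supNorm * P.supNorm := by
  by_cases hθ : θ = 0
  · simp [hθ]
  by_cases hP : P = 0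
  · simp [hP]
  exact (supNorm_mul_and_layerLambda_mul hθ hP).1

/-- `λ(θ·P) = λθ + λP` for non-zero `θ, P` over an ultrametric normed field. [cite: PollackWeston2011MT, §3.1] -/
theorem layerLambda_mul {θ P : K[X]} (hθ : θ ≠ 0) (hP : P ≠ 0) :
    layerLambda (θ * P) = layerLambda θ + layerLambda P :=
  (supNorm_mul_and_layerLambda_mul hθ hP).2

end Gauss

/-! ## §3. Reduction modulo an integral monic modulus close to `X^m` -/

section Reduction

variable {K : Type*} [NormedField K]

/-- Truncation below degree `m` (`PowerSeries.trunc`) does not increase the sup norm. [folklore] -/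
theorem supNorm_trunc_le (m : ℕ) (F : K[X]) :
    (PowerSeries.trunc m (F : PowerSeries K)).supNorm ≤ F.supNorm := by
  obtain ⟨i, hi⟩ := (PowerSeries.trunc m (F : PowerSeries K)).exists_eq_supNorm
  rw [hi, PowerSeries.coeff_trunc]
  split_ifs
  · rw [Polynomial.coeff_coe]
    exact F.le_supNorm i
  · rw [norm_zero]
    exact supNorm_nonneg F

/-- Truncation is compatible with subtraction (coefficientwise). [folklore] -/
theorem trunc_coe_sub (m : ℕ) (F G : K[X]) :
    PowerSeries.trunc m ((F - G : K[X]) : PowerSeries K) =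
      PowerSeries.trunc m (F : PowerSeries K) - PowerSeries.trunc m (G : PowerSeries K) := by
  ext k
  simp only [PowerSeries.coeff_trunc, Polynomial.coeff_sub, Polynomial.coe_sub, map_sub]

/-- Truncation is compatible with addition (coefficientwise). [folklore] -/
theorem trunc_coe_add (m : ℕ) (F G : K[X]) :
    PowerSeries.trunc m ((F + G : K[X]) : PowerSeries K) =
      PowerSeries.trunc m (F : PowerSeries K) + PowerSeries.trunc m (G : PowerSeries K) := by
  ext k
  simp only [PowerSeries.coeff_trunc, Polynomial.coeff_add, Polynomial.coe_add, map_add]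

/-- The truncation below degree `m` of a multiple of `X^m` vanishes. [folklore] -/
theorem trunc_coe_mul_X_pow (m : ℕ) (G : K[X]) :
    PowerSeries.trunc m ((G * X ^ m : K[X]) : PowerSeries K) = 0 := by
  ext k
  simp only [PowerSeries.coeff_trunc, Polynomial.coeff_coe, Polynomial.coeff_zero]
  split_ifs with hk
  · rw [Polynomial.coeff_mul_X_pow', if_neg (not_le.mpr hk)]
  · rfl

variable [IsUltrametricDist K]

/-- `‖A − B‖_sup ≤ max ‖A‖_sup ‖B‖_sup`. [folklore] -/
theorem supNorm_sub_le_max (A B : K[X]) : (A - B).supNorm ≤ max A.supNorm B.supNorm := by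
  obtain ⟨i, hi⟩ := (A - B).exists_eq_supNorm
  rw [hi, coeff_sub, sub_eq_add_neg]
  refine (IsUltrametricDist.norm_add_le_max _ _).trans ?_
  rw [norm_neg]
  exact max_le_max (A.le_supNorm i) (B.le_supNorm i)

/-- `‖A + B‖_sup ≤ max ‖A‖_sup ‖B‖_sup`. [folklore] -/
theorem supNorm_add_le_max (A B : K[X]) : (A + B).supNorm ≤ max A.supNorm B.supNorm := by
  obtain ⟨i, hi⟩ := (A + B).exists_eq_supNorm
  rw [hi, coeff_add]
  exact (IsUltrametricDist.norm_add_le_max _ _).trans (max_le_max (A.le_supNorm i) (B.le_supNorm i))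

/-- Sup-norm isosceles: if `‖E‖_sup < ‖T‖_sup` then `‖T + E‖_sup = ‖T‖_sup`. [folklore] -/
theorem supNorm_add_eq_left_of_supNorm_lt {T E : K[X]} (h : E.supNorm < T.supNorm) :
    (T + E).supNorm = T.supNorm := by
  apply le_antisymm ((supNorm_add_le_max T E).trans (max_le le_rfl h.le))
  obtain ⟨i, hi⟩ := T.exists_eq_supNorm
  have h1 : ‖E.coeff i‖ < ‖T.coeff i‖ := by rw [← hi]; exact (E.le_supNorm i).trans_lt h
  have h2 : ‖T.coeff i - (T + E).coeff i‖ < ‖T.coeff i‖ := by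
    rwa [coeff_add, sub_add_cancel_left, norm_neg]
  rw [hi, ← norm_eq_of_norm_sub_lt_norm h2]
  exact (T + E).le_supNorm i

/-- `‖X^j · G‖_sup = ‖G‖_sup`. [folklore] -/
theorem supNorm_X_pow_mul (j : ℕ) (G : K[X]) : (X ^ j * G).supNorm = G.supNorm := by
  rw [supNorm_mul', Polynomial.X_pow_eq_monomial, supNorm_monomial, norm_one, one_mul]

/-- **Reduction modulo an integral monic modulus close to `X^m`.** Let `ω` be monic of degree `m` with
`‖ω‖_sup ≤ 1` and `‖ω − X^m‖_sup ≤ δ`. Then for every polynomial `F`,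
`‖F %ₘ ω − trunc_m F‖_sup ≤ δ·‖F‖_sup`: reduction modulo `ω` agrees with truncation up to an error of relative
size `δ` (division algorithm: each step replaces `c·X^{j+m}` by `−c·X^j·(ω − X^m)`, of norm `≤ δ‖c‖`, and never
increases the sup norm; induction on the degree). [cite: Washington1997, §7.1 (division by distinguished polynomials, shape)] -/
theorem supNorm_modByMonic_sub_trunc_le {ω : K[X]} (hω : ω.Monic) (hω1 : ω.supNorm ≤ 1) {δ : ℝ}
    (hδ : (ω - X ^ ω.natDegree).supNorm ≤ δ) (F : K[X]) :
    (F %ₘ ω - PowerSeries.trunc ω.natDegree (F : PowerSeries K)).supNorm ≤ δ * F.supNorm := by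
  have hδ0 : 0 ≤ δ := (supNorm_nonneg _).trans hδ
  -- the claim for `0`
  have hzero : ∀ G : K[X], G = 0 →
      (G %ₘ ω - PowerSeries.trunc ω.natDegree (G : PowerSeries K)).supNorm ≤ δ * G.supNorm := by
    rintro G rfl
    simp [supNorm_zero]
  -- strong induction on the degree
  suffices h : ∀ d : ℕ, ∀ G : K[X], G.natDegree = d →
      (G %ₘ ω - PowerSeries.trunc ω.natDegree (G : PowerSeries K)).supNorm ≤ δ * G.supNorm from h _ F rfl
  intro d
  induction d using Nat.strong_induction_on with
  | _ d ih =>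
    intro G hGd
    by_cases hG0 : G = 0
    · exact hzero G hG0
    by_cases hlt : G.degree < ω.degree
    · -- no reduction needed: `G %ₘ ω = G = trunc_m G`
      have h1 : G %ₘ ω = G := (modByMonic_eq_self_iff hω).mpr hlt
      have h2 : PowerSeries.trunc ω.natDegree (G : PowerSeries K) = G :=
        PowerSeries.trunc_coe_eq_self (natDegree_lt_natDegree hG0 hlt)
      rw [h1, h2, sub_self, supNorm_zero]
      exact mul_nonneg hδ0 (supNorm_nonneg G)
    · -- one step of the division algorithm
      push Not at hlt
      have hmle : ω.natDegree ≤ G.natDegree := natDegree_le_natDegree hlt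
      set c := G.leadingCoeff with hc
      set j := G.natDegree - ω.natDegree with hj
      have hc0 : c ≠ 0 := leadingCoeff_ne_zero.mpr hG0
      set G' := G - C c * X ^ j * ω with hG'
      -- `G ≡ G'` modulo `ω`
      have hmod : G %ₘ ω = G' %ₘ ω :=
        modByMonic_eq_of_dvd_sub hω ⟨C c * X ^ j, by rw [hG']; ring⟩
      -- the truncations differ by `trunc_m (C c X^j (ω − X^m))`
      have hsplit : C c * X ^ j * ω =
          C c * X ^ j * (ω - X ^ ω.natDegree) + C c * X ^ j * X ^ ω.natDegree := by
        ring
      have htrunc : PowerSeries.trunc ω.natDegree (G : PowerSeries K) =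
          PowerSeries.trunc ω.natDegree (G' : PowerSeries K) +
            PowerSeries.trunc ω.natDegree ((C c * X ^ j * (ω - X ^ ω.natDegree) : K[X]) : PowerSeries K) := by
        rw [hG', trunc_coe_sub, hsplit, trunc_coe_add, trunc_coe_mul_X_pow, add_zero, sub_add_cancel]
      -- norms of the pieces
      have hcG : ‖c‖ ≤ G.supNorm := by rw [hc, leadingCoeff]; exact G.le_supNorm _
      have hpiece : (PowerSeries.trunc ω.natDegree
          ((C c * X ^ j * (ω - X ^ ω.natDegree) : K[X]) : PowerSeries K)).supNorm ≤ δ * G.supNorm := by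
        refine (supNorm_trunc_le _ _).trans ?_
        rw [mul_assoc, supNorm_mul', supNorm_C, supNorm_X_pow_mul]
        calc ‖c‖ * (ω - X ^ ω.natDegree).supNorm ≤ ‖c‖ * δ :=
              mul_le_mul_of_nonneg_left hδ (norm_nonneg c)
          _ ≤ G.supNorm * δ := mul_le_mul_of_nonneg_right hcG hδ0
          _ = δ * G.supNorm := mul_comm _ _
      have hG'le : G'.supNorm ≤ G.supNorm := by
        rw [hG']
        refine (supNorm_sub_le_max _ _).trans (max_le le_rfl ?_)
        rw [mul_assoc, supNorm_mul', supNorm_C, supNorm_X_pow_mul]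
        calc ‖c‖ * ω.supNorm ≤ ‖c‖ * 1 := mul_le_mul_of_nonneg_left hω1 (norm_nonneg c)
          _ ≤ G.supNorm := by rw [mul_one]; exact hcG
      -- the induction hypothesis for `G'` (or the trivial case `G' = 0`)
      have hIH : (G' %ₘ ω - PowerSeries.trunc ω.natDegree (G' : PowerSeries K)).supNorm ≤
          δ * G'.supNorm := by
        by_cases hG'0 : G' = 0
        · exact hzero G' hG'0
        · have hdeg : G'.degree < G.degree := by
            rw [hG']
            apply degree_sub_lt
            · rw [degree_mul, degree_mul, degree_C hc0, zero_add, degree_X_pow,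
                degree_eq_natDegree hω.ne_zero, degree_eq_natDegree hG0, ← Nat.cast_add, hj,
                Nat.sub_add_cancel hmle]
            · exact hG0
            · rw [leadingCoeff_mul, leadingCoeff_mul, leadingCoeff_C, leadingCoeff_X_pow, hω.leadingCoeff,
                mul_one, mul_one]
          exact ih G'.natDegree (hGd ▸ natDegree_lt_natDegree hG'0 hdeg) G' rfl
      -- assemble
      have heq : G' %ₘ ω - PowerSeries.trunc ω.natDegree (G : PowerSeries K) =
          (G' %ₘ ω - PowerSeries.trunc ω.natDegree (G' : PowerSeries K)) -
            PowerSeries.trunc ω.natDegree ((C c * X ^ j * (ω - X ^ ω.natDegree) : K[X]) : PowerSeries K) := by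
        rw [htrunc]; abel
      rw [hmod, heq]
      refine (supNorm_sub_le_max _ _).trans (max_le (hIH.trans ?_) hpiece)
      exact mul_le_mul_of_nonneg_left hG'le hδ0

/-! ## §4. Consequences: `λ` and the sup norm survive the reduction when `λ < m` -/

/-- `‖F %ₘ ω‖_sup ≤ ‖F‖_sup` for an integral monic `ω` (take `δ = ‖ω − X^m‖_sup ≤ 1`). [folklore] -/
theorem supNorm_modByMonic_le {ω : K[X]} (hω : ω.Monic) (hω1 : ω.supNorm ≤ 1) (F : K[X]) :
    (F %ₘ ω).supNorm ≤ F.supNorm := by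
  have hδ1 : (ω - X ^ ω.natDegree).supNorm ≤ 1 := by
    refine (supNorm_sub_le_max _ _).trans (max_le hω1 ?_)
    rw [Polynomial.X_pow_eq_monomial, supNorm_monomial, norm_one]
  have h := supNorm_modByMonic_sub_trunc_le hω hω1 le_rfl F
  have heq : F %ₘ ω = (F %ₘ ω - PowerSeries.trunc ω.natDegree (F : PowerSeries K)) +
      PowerSeries.trunc ω.natDegree (F : PowerSeries K) := by abel
  rw [heq]
  refine (supNorm_add_le_max _ _).trans (max_le (h.trans ?_) (supNorm_trunc_le _ _))
  calc (ω - X ^ ω.natDegree).supNorm * F.supNorm ≤ 1 * F.supNorm :=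
        mul_le_mul_of_nonneg_right hδ1 (supNorm_nonneg F)
    _ = F.supNorm := one_mul _

omit [IsUltrametricDist K] in
/-- If `λ(F) < m` then the truncation below `m` has the same sup norm and the same `λ` as `F`. [folklore] -/
theorem supNorm_trunc_eq_and_layerLambda_trunc_eq {F : K[X]} {m : ℕ} (hlam : layerLambda F < m) :
    (PowerSeries.trunc m (F : PowerSeries K)).supNorm = F.supNorm ∧
      layerLambda (PowerSeries.trunc m (F : PowerSeries K)) = layerLambda F := by
  set T := PowerSeries.trunc m (F : PowerSeries K) with hT
  have hcoeff : ∀ k < m, T.coeff k = F.coeff k := fun k hk ↦ by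
    rw [hT, PowerSeries.coeff_trunc, if_pos hk, Polynomial.coeff_coe]
  have hsup : T.supNorm = F.supNorm := by
    apply le_antisymm (supNorm_trunc_le m F)
    rw [← norm_coeff_layerLambda F, ← hcoeff _ hlam]
    exact T.le_supNorm _
  refine ⟨hsup, layerLambda_eq_iff.mpr ⟨?_, fun j hj ↦ ?_⟩⟩
  · rw [hsup, hcoeff _ hlam, norm_coeff_layerLambda]
  · rw [hsup, hcoeff _ (hj.trans hlam)]
    exact norm_coeff_lt_supNorm_of_lt_layerLambda hj

/-- **`λ` and the sup norm survive reduction modulo `ω` when `λ(F) < deg ω`**, for `ω` monic, integral, with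
`‖ω − X^m‖_sup < 1` (e.g. `ω_n = (X+1)^{pⁿ} − 1`, §5): `‖F %ₘ ω‖_sup = ‖F‖_sup` and `λ(F %ₘ ω) = λ(F)`.
[cite: PollackWeston2011MT, §3.1] -/
theorem supNorm_modByMonic_eq_and_layerLambda_modByMonic_eq {ω : K[X]} (hω : ω.Monic) (hω1 : ω.supNorm ≤ 1)
    (hlt : (ω - X ^ ω.natDegree).supNorm < 1) {F : K[X]} (hF : F ≠ 0)
    (hlam : layerLambda F < ω.natDegree) :
    (F %ₘ ω).supNorm = F.supNorm ∧ layerLambda (F %ₘ ω) = layerLambda F := by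
  set T := PowerSeries.trunc ω.natDegree (F : PowerSeries K) with hT
  set E := F %ₘ ω - T with hE
  obtain ⟨hTsup, hTlam⟩ := supNorm_trunc_eq_and_layerLambda_trunc_eq (F := F) hlam
  have hFpos : 0 < F.supNorm :=
    lt_of_le_of_ne (supNorm_nonneg F) (Ne.symm ((supNorm_eq_zero_iff F).not.mpr hF))
  have hElt : E.supNorm < T.supNorm := by
    rw [hTsup]
    refine (supNorm_modByMonic_sub_trunc_le hω hω1 le_rfl F).trans_lt ?_
    calc (ω - X ^ ω.natDegree).supNorm * F.supNorm < 1 * F.supNorm := mul_lt_mul_of_pos_right hlt hFpos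
      _ = F.supNorm := one_mul _
  have hdec : F %ₘ ω = T + E := by rw [hE]; abel
  have hsup : (F %ₘ ω).supNorm = F.supNorm := by
    rw [hdec, supNorm_add_eq_left_of_supNorm_lt hElt, hTsup]
  refine ⟨hsup, ?_⟩
  rw [← hTlam]
  apply layerLambda_eq_of_supNorm_sub_C_mul_lt (one_ne_zero (α := K))
  rw [map_one, one_mul, hsup, ← hTsup, ← hE]
  exact hElt

/-- **Layer product rule.** For `ω` monic, integral, with `‖ω − X^m‖_sup < 1`, and non-zero `θ, P` with
`λθ + λP < m`: `λ((θ·P) %ₘ ω) = λθ + λP` and `‖(θ·P) %ₘ ω‖_sup = ‖θ‖_sup·‖P‖_sup` — the bookkeeping behind every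
«`λ_n(θ^{S₀}_n) = λ_n(θ_n) + Σ_{v∈S₀} λ(P_v)`» identity of the route (GV §1 non-primitive shift, at the layers).
[cite: GreenbergVatsal2000, §1 (λ of non-primitive L-functions; shape)] -/
theorem layerLambda_mul_modByMonic {ω : K[X]} (hω : ω.Monic) (hω1 : ω.supNorm ≤ 1)
    (hlt : (ω - X ^ ω.natDegree).supNorm < 1) {θ P : K[X]} (hθ : θ ≠ 0) (hP : P ≠ 0)
    (hlam : layerLambda θ + layerLambda P < ω.natDegree) :
    layerLambda ((θ * P) %ₘ ω) = layerLambda θ + layerLambda P ∧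
      ((θ * P) %ₘ ω).supNorm = θ.supNorm * P.supNorm := by
  obtain ⟨hsup, hlammul⟩ := supNorm_mul_and_layerLambda_mul hθ hP
  obtain ⟨h1, h2⟩ := supNorm_modByMonic_eq_and_layerLambda_modByMonic_eq hω hω1 hlt (mul_ne_zero hθ hP)
    (hlammul ▸ hlam)
  exact ⟨h2.trans hlammul, h1.trans hsup⟩

end Reduction

end Summit.BirchSwinnertonDyer.BirchSwinnertonDyer.Theorems.ThetaLayerLambdaCongruenceAtTwo

end
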